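import Summits.ResolutionOfSingularities.ResolutionOfSingularities.Theorems.FrobeniusClosingClosingLemmaProducts
import Summits.ResolutionOfSingularities.ResolutionOfSingularities.Theorems.FrobeniusClosingClosingLemmaReindex
import Summits.ResolutionOfSingularities.ResolutionOfSingularities.Theorems.FrobeniusClosingClosingLemmaCycle
import Mathlib.RingTheory.Nullstellensatz
import Mathlib.RingTheory.Polynomial.Basic
import HarnessLib

/-!
# Closing lemma toolkit (5a): the closing round — a repeated vertex locus gives a periodic path

Route `FrobeniusClosing`, support item `ClosingLemma` (stmt-ResolutionOfSingularities-16348).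

A **walk of loci** over an algebraic closure `F` of `ZMod p` for the arena
`⋃ⱼ V(Par j) ∖ V(g)` (`g ∈ Qar j`): prime ideals `P m ⊆ F[x]` (vertex loci `X m = V(P m)`), prime
ideals `Q m ⊆ F[x, y]` (edge loci `E m = V(Q m) ⊆ X m × X (m+1)`, both projections dominant:
`Q m ∩ F[x] = P m`, `Q m ∩ F[y] = P (m+1)`), labels `j m` with `Par (j m) ⊆ Q m` and a witness
`g m ∈ Qar (j m)`, `g m ∉ Q m`.

`periodic_path_of_repeat`: if a vertex prime REPEATS, `P a = P b` with `a < b`, `r = b - a`, then the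
arena has a periodic path over a finite field (conclusion VERBATIM that of
`Theses.FrobeniusClosing.ClosingLemma`), CONDITIONALLY on the vendored twisted Lang–Weil estimate
`Varshavsky2014.cor2_affine` (hypothesis).  Proof: the cyclic product
`Ĉ = {(u, v) | (u i, v (i+1)) ∈ E (a+i) for all i mod r} ⊆ X̂ × X̂`, `X̂ = ∏ X (a+i)`, is an
irreducible (`isPrime_vanishingIdeal_pi`) bi-dominant (`vanishingIdeal_pi_eq_of_forall_eq`)
correspondence on the `𝔽_q`-variety `X̂`; Varshavsky's Cor. 2 gives `(u, Frob u) ∈ Ĉ` off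
`V(∏ g)`, i.e. a Frobenius-twisted edge cycle, and `periodic_path_of_twisted_cycle` finishes.
OURS. [folklore]
-/

noncomputable section

-- single-problem summit: the doubled namespace component `ResolutionOfSingularities` is forced
set_option linter.dupNamespace false

open MvPolynomial
open Literature.NumberTheory.DiophantineGeometry.Varshavsky2014 (locus IsDefinedOver frob cor2_affine)

namespace Summit.ResolutionOfSingularities.ResolutionOfSingularities.Theorems.FrobeniusClosing.ClosingArena

/-! ## The cyclic pairing of blocks -/

section Pairing

variable {F : Type*} {R α : Type*} (e : R × (α ⊕ α) ≃ (R × α) ⊕ (R × α)) (σ : Equiv.Perm R)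

/-- Blocks of a paired point. [folklore] -/
theorem block_comp_pair (he₁ : ∀ i s, e (i, Sum.inl s) = Sum.inl (i, s))
    (he₂ : ∀ i s, e (i, Sum.inr s) = Sum.inr (σ i, s)) (w : (R × α) ⊕ (R × α) → F) (i : R) :
    (fun s => (w ∘ e) (i, s)) =
      Sum.elim (fun s => w (Sum.inl (i, s))) (fun s => w (Sum.inr (σ i, s))) := by
  funext s
  rcases s with s | s
  · simp [he₁]
  · simp [he₂]

/-- First projection of the cyclic product of correspondences = product of first projections.
[folklore] -/
theorem image_inl_pairSet (he₁ : ∀ i s, e (i, Sum.inl s) = Sum.inl (i, s))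
    (he₂ : ∀ i s, e (i, Sum.inr s) = Sum.inr (σ i, s)) (E : R → Set (α ⊕ α → F)) :
    (fun w => w ∘ Sum.inl) '' {w : (R × α) ⊕ (R × α) → F |
        w ∘ e ∈ {v : R × (α ⊕ α) → F | ∀ i, (fun s => v (i, s)) ∈ E i}} =
      {u : R × α → F | ∀ i, (fun s => u (i, s)) ∈ (fun z => z ∘ Sum.inl) '' E i} := by
  classical
  ext u
  simp only [Set.mem_image, Set.mem_setOf_eq]
  constructor
  · rintro ⟨w, hw, rfl⟩ i
    refine ⟨_, hw i, ?_⟩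
    rw [block_comp_pair e σ he₁ he₂]
    funext s; simp
  · intro hu
    choose z hz hzu using hu
    refine ⟨Sum.elim u (fun q => z (σ.symm q.1) (Sum.inr q.2)), fun i => ?_, ?_⟩
    · rw [block_comp_pair e σ he₁ he₂]
      have : Sum.elim (fun s => Sum.elim u (fun q : R × α => z (σ.symm q.1) (Sum.inr q.2))
            (Sum.inl (i, s)))
          (fun s => Sum.elim u (fun q : R × α => z (σ.symm q.1) (Sum.inr q.2))
            (Sum.inr (σ i, s))) = z i := by
        funext s
        rcases s with s | s
        · simpa using (congrFun (hzu i) s).symm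
        · simp
      rw [this]; exact hz i
    · funext q; simp

/-- Second projection of the cyclic product of correspondences = (rotated) product of second
projections. [folklore] -/
theorem image_inr_pairSet (he₁ : ∀ i s, e (i, Sum.inl s) = Sum.inl (i, s))
    (he₂ : ∀ i s, e (i, Sum.inr s) = Sum.inr (σ i, s)) (E : R → Set (α ⊕ α → F)) :
    (fun w => w ∘ Sum.inr) '' {w : (R × α) ⊕ (R × α) → F |
        w ∘ e ∈ {v : R × (α ⊕ α) → F | ∀ i, (fun s => v (i, s)) ∈ E i}} =
      {v : R × α → F | ∀ i, (fun s => v (i, s)) ∈ (fun z => z ∘ Sum.inr) '' E (σ.symm i)} := by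
  classical
  ext v
  simp only [Set.mem_image, Set.mem_setOf_eq]
  constructor
  · rintro ⟨w, hw, rfl⟩ i
    refine ⟨_, hw (σ.symm i), ?_⟩
    rw [block_comp_pair e σ he₁ he₂]
    funext s; simp
  · intro hv
    choose z hz hzv using hv
    refine ⟨Sum.elim (fun q => z (σ q.1) (Sum.inl q.2)) v, fun i => ?_, ?_⟩
    · rw [block_comp_pair e σ he₁ he₂]
      have : Sum.elim (fun s => Sum.elim (fun q : R × α => z (σ q.1) (Sum.inl q.2)) v
            (Sum.inl (i, s)))
          (fun s => Sum.elim (fun q : R × α => z (σ q.1) (Sum.inl q.2)) v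
            (Sum.inr (σ i, s))) = z (σ i) := by
        funext s
        rcases s with s | s
        · simp
        · simpa using (congrFun (hzv (σ i)) s).symm
      rw [this]
      simpa using hz (σ i)
    · funext q; simp

end Pairing

/-! ## Definedness over a finite field -/

/-- `IsDefinedOver` is preserved by renaming along an injective map (new coefficients are old
ones or `0`). [folklore] -/
theorem isDefinedOver_rename_of_injective {F : Type*} [Field F] {α β : Type*} {ρ : α → β}
    (hρ : Function.Injective ρ) {q : ℕ} (hq : q ≠ 0) {f : MvPolynomial α F}
    (hf : IsDefinedOver q f) : IsDefinedOver q (rename ρ f) := by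
  classical
  intro m
  by_cases hm : ∃ u, Finsupp.mapDomain ρ u = m
  · obtain ⟨u, rfl⟩ := hm
    rw [coeff_rename_mapDomain _ hρ]
    exact hf u
  · push Not at hm
    rw [coeff_rename_eq_zero _ _ _ (fun u hu => absurd hu (hm u)), zero_pow hq]

/-! ## The closing round -/

/-- **The closing round (conditional on `Varshavsky2014.cor2_affine`).**  A walk of loci of the
arena `⋃ⱼ V(Par j) ∖ V(g)` over an algebraic closure of `ZMod p` whose vertex prime repeats
(`P a = P b`, `a < b`) yields a periodic path of the arena over a finite field — the conclusion of
`Theses.FrobeniusClosing.ClosingLemma`, verbatim. [cite: Varshavsky2014, Cor. 2]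
[cite: Hrushovski2004, Cor. 1.2] -/
theorem periodic_path_of_repeat (hcor2 : cor2_affine) (p : ℕ) [Fact p.Prime] (F : Type) [Field F]
    [Algebra (ZMod p) F] [IsAlgClosed F] [Algebra.IsAlgebraic (ZMod p) F] {N k : ℕ}
    (Par Qar : Fin k → Finset (MvPolynomial (Fin N ⊕ Fin N) (ZMod p)))
    (P : ℕ → Ideal (MvPolynomial (Fin N) F)) (Q : ℕ → Ideal (MvPolynomial (Fin N ⊕ Fin N) F))
    (j : ℕ → Fin k) (g : ℕ → MvPolynomial (Fin N ⊕ Fin N) F)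
    (hP : ∀ m, (P m).IsPrime) (hQ : ∀ m, (Q m).IsPrime)
    (h1 : ∀ m f, rename Sum.inl f ∈ Q m ↔ f ∈ P m)
    (h2 : ∀ m f, rename Sum.inr f ∈ Q m ↔ f ∈ P (m + 1))
    (h3 : ∀ m, (map (algebraMap (ZMod p) F)) ''
      ((Par (j m) : Finset (MvPolynomial (Fin N ⊕ Fin N) (ZMod p))) : Set _) ⊆
      (Q m : Set (MvPolynomial (Fin N ⊕ Fin N) F)))
    (h4 : ∀ m, g m ∈ (map (algebraMap (ZMod p) F)) ''
      ((Qar (j m) : Finset (MvPolynomial (Fin N ⊕ Fin N) (ZMod p))) : Set _) ∧ g m ∉ Q m)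
    {a b : ℕ} (hab : a < b) (hrep : P a = P b) :
    ∃ (K : Type) (_ : Field K) (_ : Algebra (ZMod p) K) (_ : Finite K) (w : ℕ → Fin N → K)
      (R : ℕ), 0 < R ∧ (∀ m, w (m + R) = w m) ∧
      ∀ m, ∃ j, (∀ f ∈ Par j, MvPolynomial.aeval (Sum.elim (w m) (w (m + 1))) f = 0) ∧
        ∃ g ∈ Qar j, MvPolynomial.aeval (Sum.elim (w m) (w (m + 1))) g ≠ 0 := by
  classical
  obtain ⟨r', rfl⟩ := Nat.exists_eq_add_of_lt hab
  -- the cyclic successor on the blocks `Fin (r'+1)` and the index bookkeeping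
  set σ : Equiv.Perm (Fin (r' + 1)) := finRotate (r' + 1) with hσ
  have hsucc : ∀ i : Fin (r' + 1), P (a + i + 1) = P (a + (σ i : ℕ)) := by
    intro i
    by_cases hi : i = Fin.last r'
    · subst hi
      rw [hσ, finRotate_last, Fin.val_last, Fin.val_zero, Nat.add_zero]
      exact hrep.symm
    · rw [hσ, coe_finRotate_of_ne_last hi, Nat.add_assoc]
  -- the loci
  set X : Fin (r' + 1) → Set (Fin N → F) := fun i => zeroLocus F (P (a + i)) with hX
  set E : Fin (r' + 1) → Set (Fin N ⊕ Fin N → F) := fun i => zeroLocus F (Q (a + i)) with hE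
  have hXI : ∀ i, vanishingIdeal F (X i) = P (a + i) := fun i => by
    haveI := hP (a + i); exact IsPrime.vanishingIdeal_zeroLocus _
  have hEI : ∀ i, vanishingIdeal F (E i) = Q (a + i) := fun i => by
    haveI := hQ (a + i); exact IsPrime.vanishingIdeal_zeroLocus _
  have hXprime : ∀ i, (vanishingIdeal F (X i)).IsPrime := fun i => (hXI i).symm ▸ hP _
  have hEprime : ∀ i, (vanishingIdeal F (E i)).IsPrime := fun i => (hEI i).symm ▸ hQ _
  -- edges lie over vertices
  have he1 : ∀ i, ∀ z ∈ E i, z ∘ Sum.inl ∈ X i := by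
    intro i z hz
    simp only [hX, mem_zeroLocus_iff]
    intro f hf
    rw [← aeval_rename]
    exact (mem_zeroLocus_iff.1 hz) _ ((h1 _ f).2 hf)
  have he2 : ∀ i, ∀ z ∈ E i, z ∘ Sum.inr ∈ X (σ i) := by
    intro i z hz
    simp only [hX, mem_zeroLocus_iff]
    intro f hf
    rw [← hsucc] at hf
    rw [← aeval_rename]
    exact (mem_zeroLocus_iff.1 hz) _ ((h2 _ f).2 hf)
  -- dominance of the two projections, blockwise
  have hd1 : ∀ i, vanishingIdeal F ((fun z => z ∘ Sum.inl) '' E i) = vanishingIdeal F (X i) := by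
    intro i
    apply le_antisymm
    · intro f hf
      rw [hXI, ← h1, ← hEI, mem_vanishingIdeal_iff]
      intro z hz
      rw [aeval_rename]
      exact (mem_vanishingIdeal_iff.1 hf) _ ⟨z, hz, rfl⟩
    · apply vanishingIdeal_anti_mono
      rintro _ ⟨z, hz, rfl⟩
      exact he1 i z hz
  have hd2 : ∀ i, vanishingIdeal F ((fun z => z ∘ Sum.inr) '' E i) =
      vanishingIdeal F (X (σ i)) := by
    intro i
    apply le_antisymm
    · intro f hf
      rw [hXI, ← hsucc, ← h2, ← hEI, mem_vanishingIdeal_iff]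
      intro z hz
      rw [aeval_rename]
      exact (mem_vanishingIdeal_iff.1 hf) _ ⟨z, hz, rfl⟩
    · apply vanishingIdeal_anti_mono
      rintro _ ⟨z, hz, rfl⟩
      exact he2 i z hz
  -- the cyclic pairing of blocks
  set e : Fin (r' + 1) × (Fin N ⊕ Fin N) ≃ (Fin (r' + 1) × Fin N) ⊕ (Fin (r' + 1) × Fin N) :=
    (Equiv.prodSumDistrib _ _ _).trans
      (Equiv.sumCongr (Equiv.refl _) (Equiv.prodCongr σ (Equiv.refl _))) with he
  have he₁ : ∀ i s, e (i, Sum.inl s) = Sum.inl (i, s) := fun i s => by simp [he]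
  have he₂ : ∀ i s, e (i, Sum.inr s) = Sum.inr (σ i, s) := fun i s => by simp [he]
  -- the product sets
  set Xhat : Set (Fin (r' + 1) × Fin N → F) := {u | ∀ i, (fun s => u (i, s)) ∈ X i} with hXhat
  set Ehat : Set (Fin (r' + 1) × (Fin N ⊕ Fin N) → F) := {v | ∀ i, (fun s => v (i, s)) ∈ E i}
    with hEhat
  set Chat : Set ((Fin (r' + 1) × Fin N) ⊕ (Fin (r' + 1) × Fin N) → F) := {w | w ∘ e ∈ Ehat}
    with hChat
  -- generators of the vertex primes, defined over a common finite field
  have hfg : ∀ i : Fin (r' + 1), ∃ s : Finset (MvPolynomial (Fin N) F),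
      Ideal.span (s : Set _) = P (a + i) :=
    fun i => (inferInstance : IsNoetherian _ _).noetherian (P (a + i))
  choose gens hgens using hfg
  set cs : Finset F := Finset.univ.biUnion
    (fun i => (gens i).biUnion (fun f => f.support.image (fun m => coeff m f))) with hcs
  obtain ⟨d₀, hd₀, hfix⟩ := exists_pow_prime_pow_eq_self p cs
  have hq0 : p ^ d₀ ≠ 0 := pow_ne_zero _ (Nat.Prime.ne_zero Fact.out)
  have hgensdef : ∀ i, ∀ f ∈ gens i, IsDefinedOver (p ^ d₀) f := by
    intro i f hf m
    by_cases hm : m ∈ f.support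
    · apply hfix
      rw [hcs, Finset.mem_biUnion]
      exact ⟨i, Finset.mem_univ _, Finset.mem_biUnion.2 ⟨f, hf, Finset.mem_image.2 ⟨m, hm, rfl⟩⟩⟩
    · rw [notMem_support_iff.1 hm, zero_pow hq0]
  -- Varshavsky data: equations of `Xhat` and `Chat`
  set S : Set (MvPolynomial (Fin (r' + 1) × Fin N) F) :=
    ⋃ i, (rename (Prod.mk i)) '' (gens i : Set _) with hS
  set T : Set (MvPolynomial ((Fin (r' + 1) × Fin N) ⊕ (Fin (r' + 1) × Fin N)) F) :=
    ⋃ i, (rename (fun s => e (i, s))) '' (Q (a + i) : Set _) with hT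
  have hlocS : locus S 1 = Xhat := by
    ext u
    simp only [locus, hS, Set.mem_iUnion, Set.mem_image, map_one, ne_eq, one_ne_zero,
      not_false_eq_true, and_true, Set.mem_setOf_eq, hXhat]
    constructor
    · intro hu i
      show (fun s => u (i, s)) ∈ zeroLocus F (P (a + i))
      rw [← hgens i, zeroLocus_span]
      intro f hf
      have h0 := hu _ ⟨i, f, hf, rfl⟩
      rw [eval_rename] at h0
      exact h0
    · rintro hu _ ⟨i, f, hf, rfl⟩
      have hui : (fun s => u (i, s)) ∈ zeroLocus F (P (a + i)) := hu i
      rw [← hgens i, zeroLocus_span] at hui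
      have h0 := hui f hf
      rw [eval_rename]
      exact h0
  have hlocT : locus T 1 = Chat := by
    ext w
    simp only [locus, hT, Set.mem_iUnion, Set.mem_image, map_one, ne_eq, one_ne_zero,
      not_false_eq_true, and_true, Set.mem_setOf_eq, hChat, hEhat]
    constructor
    · intro hw i
      show (fun s => (w ∘ e) (i, s)) ∈ zeroLocus F (Q (a + i))
      rw [mem_zeroLocus_iff]
      intro f hf
      have h0 := hw _ ⟨i, f, hf, rfl⟩
      rw [eval_rename] at h0
      exact h0
    · rintro hw _ ⟨i, f, hf, rfl⟩
      have hwi : (fun s => (w ∘ e) (i, s)) ∈ zeroLocus F (Q (a + i)) := hw i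
      have h0 := (mem_zeroLocus_iff.1 hwi) f hf
      rw [eval_rename]
      exact h0
  have hSdef : ∀ f ∈ S, IsDefinedOver (p ^ d₀) f := by
    rintro _ ⟨_, ⟨i, rfl⟩, f, hf, rfl⟩
    exact isDefinedOver_rename_of_injective (fun s₁ s₂ h => (Prod.mk.inj h).2) hq0
      (hgensdef i f hf)
  have h1def : IsDefinedOver (p ^ d₀) (1 : MvPolynomial (Fin (r' + 1) × Fin N) F) := by
    intro m
    rw [coeff_one]
    split_ifs
    · exact one_pow _
    · exact zero_pow hq0
  have hXhatprime : (vanishingIdeal F (locus S 1)).IsPrime := by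
    rw [hlocS]; exact isPrime_vanishingIdeal_pi X hXprime
  have hChatprime : (vanishingIdeal F (locus T 1)).IsPrime := by
    rw [hlocT]; exact isPrime_vanishingIdeal_reindex e Ehat (isPrime_vanishingIdeal_pi E hEprime)
  have hsubC : ∀ w ∈ locus T 1, (w ∘ Sum.inl) ∈ locus S 1 ∧ (w ∘ Sum.inr) ∈ locus S 1 := by
    intro w hw
    rw [hlocT] at hw
    rw [hlocS]
    have hw' : ∀ i, (fun s => (w ∘ e) (i, s)) ∈ E i := hw
    constructor
    · intro i
      have h := he1 i _ (hw' i)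
      rw [block_comp_pair e σ he₁ he₂] at h
      simpa using h
    · intro i
      have h := he2 (σ.symm i) _ (hw' (σ.symm i))
      rw [block_comp_pair e σ he₁ he₂] at h
      simpa using h
  have hdomC₁ : vanishingIdeal F ((fun w => w ∘ Sum.inl) '' locus T 1) =
      vanishingIdeal F (locus S 1) := by
    rw [hlocT, hlocS, hChat, hEhat, image_inl_pairSet e σ he₁ he₂ E]
    exact vanishingIdeal_pi_eq_of_forall_eq _ _ hd1
  have hdomC₂ : vanishingIdeal F ((fun w => w ∘ Sum.inr) '' locus T 1) =
      vanishingIdeal F (locus S 1) := by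
    rw [hlocT, hlocS, hChat, hEhat, image_inr_pairSet e σ he₁ he₂ E]
    refine vanishingIdeal_pi_eq_of_forall_eq _ _ fun i => ?_
    rw [hd2, Equiv.apply_symm_apply]
  -- the open condition: off `V(∏ g)`
  set h' : MvPolynomial ((Fin (r' + 1) × Fin N) ⊕ (Fin (r' + 1) × Fin N)) F :=
    ∏ i, rename (fun s => e (i, s)) (g (a + i)) with hh'
  have hz : ∀ i, ∃ z ∈ E i, aeval z (g (a + i)) ≠ 0 := by
    intro i
    apply exists_aeval_ne_zero_of_not_mem
    rw [hEI]
    exact (h4 _).2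
  choose z hzE hzg using hz
  have hh'w : ∃ w ∈ locus T 1, MvPolynomial.eval w h' ≠ 0 := by
    refine ⟨fun c => z (e.symm c).1 (e.symm c).2, ?_, ?_⟩
    · rw [hlocT]
      show (fun q => z (e.symm (e q)).1 (e.symm (e q)).2) ∈ Ehat
      intro i
      simpa using hzE i
    · rw [hh', map_prod, Finset.prod_ne_zero_iff]
      intro i _
      rw [eval_rename]
      have : ((fun c => z (e.symm c).1 (e.symm c).2) ∘ fun s => e (i, s)) = z i := by
        funext s; simp
      rw [this]
      exact hzg i
  -- TWISTED LANG–WEIL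
  obtain ⟨n, w, -, hw, hne, hfrob⟩ := cor2_of_fintype hcor2 p F d₀ hd₀ S 1 T 1 hSdef h1def
    hXhatprime hChatprime hsubC hdomC₁ hdomC₂ 0 h' hh'w
  -- the twisted edge cycle
  rw [hlocT] at hw
  have hw' : ∀ i, (fun s => (w ∘ e) (i, s)) ∈ E i := hw
  set u : Fin (r' + 1) → Fin N → F := fun i s => w (Sum.inl (i, s)) with hu
  have hv : ∀ i s, w (Sum.inr (i, s)) = u i s ^ p ^ (d₀ * n) := by
    intro i s
    have := congrFun hfrob (i, s)
    simp only [Function.comp_apply, frob] at this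
    rw [this, pow_mul]
  have hpair : ∀ i, (fun s => (w ∘ e) (i, s)) =
      Sum.elim (u i) (fun s => u (σ i) s ^ p ^ (d₀ * n)) := by
    intro i
    rw [block_comp_pair e σ he₁ he₂]
    congr 1
    funext s
    exact hv _ _
  have hedge : ∀ i, Sum.elim (u i) (fun s => u (σ i) s ^ p ^ (d₀ * n)) ∈ E i := fun i =>
    hpair i ▸ hw' i
  refine periodic_path_of_twisted_cycle p F Par Qar u (d₀ * n) (fun i => j (a + i)) ?_ ?_
  · intro i f hf
    have hmem : map (algebraMap (ZMod p) F) f ∈ Q (a + i) := h3 _ ⟨f, hf, rfl⟩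
    have h0 := (mem_zeroLocus_iff.1 (hedge i)) _ hmem
    rwa [aeval_map_algebraMap] at h0
  · intro i
    obtain ⟨gg, hgg, hgeq⟩ := (h4 (a + i)).1
    refine ⟨gg, hgg, ?_⟩
    rw [← aeval_map_algebraMap F, hgeq, ← hpair i]
    have hfac := (Finset.prod_ne_zero_iff.1 (by rw [hh', map_prod] at hne; exact hne)) i
      (Finset.mem_univ _)
    rw [eval_rename] at hfac
    exact hfac

end Summit.ResolutionOfSingularities.ResolutionOfSingularities.Theorems.FrobeniusClosing.ClosingArena

end
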